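import Literature.AlgebraicGeometry.Modules.AffineStrata
import HarnessLib

/-!
# RELATIVE EDITION (ring base `R`) — The prime strata of an affine base: `P ×_R Spec(A⧸𝔭) ↪ P ×_R T`

RELATIVE EDITION of ★ `Modules/AffineStrata` (cell `hodgecm-mathlib`, F-DAG hand (h8-E) «engine of the relative
seesaw», file E1; author B-p08 (g12); plan of record `B-provers/B-p08/g11/PORTMAP-h8-RelativeSeesaw.B-p08g11.md` §2 rows
E1–E8, un-parked by B-plan1 (g15) 2026-08-30T04:48:23Z): the ★ file is typed `{K : Type u} [Field K] (T : SchemeOver K)`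
but uses the field NOWHERE — ★ `Motives.SchemeOver (k) [CommRing k] := Over (Spec k)` is already over a commutative ring,
the integrality of the strata total spaces is Mathlib's base-general `GeometricallyIntegral.isIntegral_of_isLocallyNoetherian`
under the explicit binders `[Flat P.hom] [UniversallyOpen P.hom]`, and the one base-specific input, the cartesian square
★ `Motives.isPullback_whiskerLeft_snd` (typed over a field), is re-proved here over ANY base scheme and universe
(`Motives.isPullback_whiskerLeft_snd_overBase`; same proof as ★ and as the universe-`0` ★
`SeesawRelative.isPullback_whiskerLeft_snd_over` of `Motives/SeesawRelativeTrivFromBaseLocal`).  Decl for decl the twin of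
★ `AffineStrata` with `K ↦ R` (namespace `Literature.AlgebraicGeometry.Modules.Relative`; the scheme binder
`(T : SchemeOver R)` is written explicitly in every header):
`Relative.quotHom` · `stratumToBase` · `stratum` · `stratumι` · `stratum_left` · `stratumι_left` · the instances
`isAffine_stratum_left` / `isIntegral_stratum_left` / `isLocallyNoetherian_stratum_left` / `isClosedImmersion_stratumToBase` /
`isClosedImmersion_stratumι_left` · `stratumRingIso` · `stratumι_appTop_comp_stratumRingIso_hom` · `stratumRingIso_hom_appTop` ·
`isIntegral_tensorObj_stratum_left` · `isClosedImmersion_whiskerLeft_stratumι_left` · `isAffineHom_whiskerLeft_stratumι_left` ·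
`isAffineOpen_preimage_whiskerLeft_stratumι`.  Everything is proved; no named facts, no `sorry`.  HC_CM is proved only modulo the
7 printed citations until rung 0 closes; this file asserts nothing about HC.  Original module docstring (read `K` as `R`):

For `T` an affine `K`-scheme with ring `A = Γ(T, 𝒪_T)` and a prime `𝔭` of `A`, the **stratum**
`T_𝔭 = Spec(A⧸𝔭) → T → Spec K` is an affine integral `K`-scheme with a closed immersion `T_𝔭 ↪ T`
(`Modules.stratum`, `Modules.stratumι`); for `P → Spec K` geometrically integral (flat, universally open)
and `A` noetherian the total space `P ×_K T_𝔭` is INTEGRAL (Görtz–Wedhorn I, Prop. 5.51) and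
`P ×_K T_𝔭 ↪ P ×_K T` is a closed immersion (cartesian over `T_𝔭 ↪ T`, Görtz–Wedhorn I, Prop. 4.16).
The ring of `T_𝔭` is `A⧸𝔭` compatibly with the structure maps (`stratumRingIso`,
`stratumι_appTop_comp_stratumRingIso_hom`). This is the geometric indexing of the noetherian dévissage of
`Literature/Algebra/Homology/OrderedCechSystemDevissage` (Görtz–Wedhorn II, proof of Thm. 23.133, Step (I)).

## References

* U. Görtz, T. Wedhorn, *Algebraic Geometry I: Schemes*, 2nd ed. (2020), Prop. 4.16 (p. 101); Prop. 5.51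
  (p. 139). [GortzWedhorn2020]
* U. Görtz, T. Wedhorn, *Algebraic Geometry II: Cohomology of Schemes* (2023),
  doi:10.1007/978-3-658-43031-3: Thm. 23.133, proof, Step (I) (p. 354). [GortzWedhorn2023]
* A. Grothendieck, EGA III₂ (Publ. Math. IHÉS 17, 1963), (6.10.5). [EGA3]
* D. Mumford, *Abelian Varieties*, TIFR Studies in Mathematics 5 (1970), §5. [MumfordAV1970]
-/

set_option autoImplicit false

universe u

open CategoryTheory CategoryTheory.Limits AlgebraicGeometry TopologicalSpace Opposite MonoidalCategory
open CartesianMonoidalCategory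
open Literature.AlgebraicGeometry.Motives

set_option backward.isDefEq.respectTransparency false

noncomputable section

namespace Literature.AlgebraicGeometry.Motives

/-- **`X ×_B T′ ≅ (X ×_B T) ×_T T′` over ANY base scheme `B`, any universe**: the square `(X ◁ f, pr_{T′}; pr_T, f)`
of the cartesian-monoidal `Over B` is cartesian ([GortzWedhorn2020] Prop. 4.16; ★ `isPullback_whiskerLeft_snd` is the case
`B = Spec K`, `K` a field, ★ `SeesawRelative.isPullback_whiskerLeft_snd_over` the universe-`0` case — same proof).
[cite: GortzWedhorn2020, Prop. 4.16 (p. 101)] -/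
theorem isPullback_whiskerLeft_snd_overBase {B : Scheme.{u}} (X : Over B) {T T' : Over B} (f : T' ⟶ T) :
    IsPullback (X ◁ f).left (snd X T').left (snd X T).left f.left := by
  have big : IsPullback ((X ◁ f).left ≫ (fst X T).left) (snd X T').left X.hom (f.left ≫ T.hom) := by
    have e₁ : (X ◁ f).left ≫ (fst X T).left = (fst X T').left := by
      rw [← Over.comp_left, whiskerLeft_fst]
    have e₂ : f.left ≫ T.hom = T'.hom := Over.w f
    rw [e₁, e₂]
    exact IsPullback.of_hasPullback X.hom T'.hom
  have comm : (X ◁ f).left ≫ (snd X T).left = (snd X T').left ≫ f.left := by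
    rw [← Over.comp_left, whiskerLeft_snd, Over.comp_left]
  exact IsPullback.of_right big comm (IsPullback.of_hasPullback X.hom T.hom)

end Literature.AlgebraicGeometry.Motives

namespace Literature.AlgebraicGeometry.Modules

namespace Relative

variable {R : Type u} [CommRing R]

/-! ### The stratum `T_𝔭 = Spec(A⧸𝔭)` -/

section Stratum

/-- The quotient map `A → A⧸𝔭` in `CommRingCat` (relative edition of ★ `Modules.quotHom`). [folklore] [cite: GortzWedhorn2023, Thm. 23.133, proof, Step (I) (p. 354)] -/
abbrev quotHom (T : SchemeOver R) (𝔭 : PrimeSpectrum Γ(T.left, ⊤)) :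
    Γ(T.left, ⊤) ⟶ CommRingCat.of (Γ(T.left, ⊤) ⧸ 𝔭.asIdeal) :=
  CommRingCat.ofHom (Ideal.Quotient.mk 𝔭.asIdeal)

/-- The morphism `Spec(A⧸𝔭) → T` (`T` affine with ring `A`; relative edition of ★ `Modules.stratumToBase`). [folklore] [cite: GortzWedhorn2023, Thm. 23.133, proof, Step (I) (p. 354)] -/
def stratumToBase (T : SchemeOver R) [IsAffine T.left] (𝔭 : PrimeSpectrum Γ(T.left, ⊤)) :
    Spec (CommRingCat.of (Γ(T.left, ⊤) ⧸ 𝔭.asIdeal)) ⟶ T.left :=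
  Spec.map (Relative.quotHom T 𝔭) ≫ T.left.isoSpec.inv

/-- **The stratum `T_𝔭 = Spec(A⧸𝔭)` as an `R`-scheme** (through `T`; relative edition of ★ `Modules.stratum`). [folklore] [cite: GortzWedhorn2023, Thm. 23.133, proof, Step (I) (p. 354)] -/
def stratum (T : SchemeOver R) [IsAffine T.left] (𝔭 : PrimeSpectrum Γ(T.left, ⊤)) : SchemeOver R :=
  Over.mk (Relative.stratumToBase T 𝔭 ≫ T.hom)

/-- The structure morphism `T_𝔭 ⟶ T` over `R` (relative edition of ★ `Modules.stratumι`). [folklore] [cite: GortzWedhorn2023, Thm. 23.133, proof, Step (I) (p. 354)] -/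
def stratumι (T : SchemeOver R) [IsAffine T.left] (𝔭 : PrimeSpectrum Γ(T.left, ⊤)) : Relative.stratum T 𝔭 ⟶ T :=
  Over.homMk (Relative.stratumToBase T 𝔭) rfl

/-- The underlying scheme of the stratum is `Spec(A⧸𝔭)`. [folklore] [cite: GortzWedhorn2023, Thm. 23.133, proof, Step (I) (p. 354)] -/
@[simp] theorem stratum_left (T : SchemeOver R) [IsAffine T.left] (𝔭 : PrimeSpectrum Γ(T.left, ⊤)) :
    (Relative.stratum T 𝔭).left = Spec (CommRingCat.of (Γ(T.left, ⊤) ⧸ 𝔭.asIdeal)) := rfl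

/-- The underlying morphism of `stratumι`. [folklore] [cite: GortzWedhorn2023, Thm. 23.133, proof, Step (I) (p. 354)] -/
@[simp] theorem stratumι_left (T : SchemeOver R) [IsAffine T.left] (𝔭 : PrimeSpectrum Γ(T.left, ⊤)) :
    (Relative.stratumι T 𝔭).left = Relative.stratumToBase T 𝔭 := rfl

/-- The stratum is affine. [folklore] [cite: GortzWedhorn2023, Thm. 23.133, proof, Step (I) (p. 354)] -/
instance isAffine_stratum_left (T : SchemeOver R) [IsAffine T.left] (𝔭 : PrimeSpectrum Γ(T.left, ⊤)) :
    IsAffine (Relative.stratum T 𝔭).left :=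
  inferInstanceAs (IsAffine (Spec _))

/-- The stratum is integral (`A⧸𝔭` is a domain). [folklore] [cite: GortzWedhorn2023, Thm. 23.133, proof, Step (I) (p. 354)] -/
instance isIntegral_stratum_left (T : SchemeOver R) [IsAffine T.left] (𝔭 : PrimeSpectrum Γ(T.left, ⊤)) :
    IsIntegral (Relative.stratum T 𝔭).left := by
  change IsIntegral (Spec (CommRingCat.of (Γ(T.left, ⊤) ⧸ 𝔭.asIdeal)))
  infer_instance

/-- The stratum is locally noetherian when `A` is noetherian. [folklore] [cite: GortzWedhorn2023, Thm. 23.133, proof, Step (I) (p. 354)] -/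
instance isLocallyNoetherian_stratum_left (T : SchemeOver R) [IsAffine T.left] (𝔭 : PrimeSpectrum Γ(T.left, ⊤))
    [IsNoetherianRing Γ(T.left, ⊤)] : IsLocallyNoetherian (Relative.stratum T 𝔭).left := by
  change IsLocallyNoetherian (Spec (CommRingCat.of (Γ(T.left, ⊤) ⧸ 𝔭.asIdeal)))
  infer_instance

/-- `T_𝔭 ↪ T` is a closed immersion. [folklore] [cite: GortzWedhorn2023, Thm. 23.133, proof, Step (I) (p. 354)] -/
instance isClosedImmersion_stratumToBase (T : SchemeOver R) [IsAffine T.left] (𝔭 : PrimeSpectrum Γ(T.left, ⊤)) :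
    IsClosedImmersion (Relative.stratumToBase T 𝔭) := by
  unfold Relative.stratumToBase
  haveI : IsClosedImmersion (Spec.map (Relative.quotHom T 𝔭)) :=
    IsClosedImmersion.spec_of_surjective _ Ideal.Quotient.mk_surjective
  infer_instance

/-- `(stratumι).left` is a closed immersion. [folklore] [cite: GortzWedhorn2023, Thm. 23.133, proof, Step (I) (p. 354)] -/
instance isClosedImmersion_stratumι_left (T : SchemeOver R) [IsAffine T.left] (𝔭 : PrimeSpectrum Γ(T.left, ⊤)) :
    IsClosedImmersion (Relative.stratumι T 𝔭).left :=
  Relative.isClosedImmersion_stratumToBase T 𝔭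

/-! ### The ring of the stratum is `A⧸𝔭` -/

/-- The ring isomorphism `Γ(T_𝔭, 𝒪) ≅ A⧸𝔭` (Mathlib `Scheme.ΓSpecIso`; relative edition of ★ `Modules.stratumRingIso`). [folklore] [cite: GortzWedhorn2023, Thm. 23.133, proof, Step (I) (p. 354)] -/
def stratumRingIso (T : SchemeOver R) [IsAffine T.left] (𝔭 : PrimeSpectrum Γ(T.left, ⊤)) :
    Γ((Relative.stratum T 𝔭).left, ⊤) ≅ CommRingCat.of (Γ(T.left, ⊤) ⧸ 𝔭.asIdeal) :=
  Scheme.ΓSpecIso _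

/-- **The structure map `A → Γ(T_𝔭, 𝒪)` followed by `Γ(T_𝔭, 𝒪) ≅ A⧸𝔭` is the quotient map.** [folklore] [cite: GortzWedhorn2023, Thm. 23.133, proof, Step (I) (p. 354)] -/
theorem stratumι_appTop_comp_stratumRingIso_hom (T : SchemeOver R) [IsAffine T.left]
    (𝔭 : PrimeSpectrum Γ(T.left, ⊤)) :
    (Relative.stratumι T 𝔭).left.appTop ≫ (Relative.stratumRingIso T 𝔭).hom = Relative.quotHom T 𝔭 := by
  rw [stratumι_left, Relative.stratumToBase, Scheme.Hom.comp_appTop, Category.assoc, Relative.stratumRingIso,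
    Scheme.ΓSpecIso_naturality, ← Category.assoc]
  have h : T.left.isoSpec.inv.appTop ≫ (Scheme.ΓSpecIso Γ(T.left, ⊤)).hom = 𝟙 _ := by
    rw [← Scheme.toSpecΓ_appTop, ← Scheme.Hom.comp_appTop, Scheme.isoSpec, asIso_inv,
      IsIso.hom_inv_id, Scheme.Hom.id_appTop]
  rw [h, Category.id_comp]

/-- Elementwise form: `e(ι♯ a) = a mod 𝔭`. [folklore] [cite: GortzWedhorn2023, Thm. 23.133, proof, Step (I) (p. 354)] -/
theorem stratumRingIso_hom_appTop (T : SchemeOver R) [IsAffine T.left] (𝔭 : PrimeSpectrum Γ(T.left, ⊤))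
    (a : Γ(T.left, ⊤)) :
    (Relative.stratumRingIso T 𝔭).hom ((Relative.stratumι T 𝔭).left.appTop a) = Ideal.Quotient.mk 𝔭.asIdeal a := by
  have := congrArg (fun φ => φ a)
    (congrArg CommRingCat.Hom.hom (Relative.stratumι_appTop_comp_stratumRingIso_hom T 𝔭))
  simpa using this

end Stratum

/-! ### The total space of a stratum -/

section Total

/-- **`P ×_R T_𝔭` is integral** for `P` geometrically integral, flat and universally open over `R` and
`A` noetherian (Görtz–Wedhorn I, Prop. 5.51; Mathlib `GeometricallyIntegral.isIntegral_of_isLocallyNoetherian`;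
relative edition of ★ `Modules.isIntegral_tensorObj_stratum_left`). [cite: GortzWedhorn2020, Prop. 5.51 (p. 139)] -/
instance isIntegral_tensorObj_stratum_left (T : SchemeOver R) [IsAffine T.left] (P : SchemeOver R)
    (𝔭 : PrimeSpectrum Γ(T.left, ⊤)) [GeometricallyIntegral P.hom] [Flat P.hom] [UniversallyOpen P.hom]
    [IsNoetherianRing Γ(T.left, ⊤)] : IsIntegral (P ⊗ Relative.stratum T 𝔭).left :=
  inferInstanceAs (IsIntegral (pullback P.hom (Relative.stratum T 𝔭).hom))

/-- **`P ×_R T_𝔭 ↪ P ×_R T` is a closed immersion** (base change of `T_𝔭 ↪ T` along `P ×_R T → T`,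
`Motives.isPullback_whiskerLeft_snd_overBase`; relative edition of ★ `Modules.isClosedImmersion_whiskerLeft_stratumι_left`).
[cite: GortzWedhorn2020, Prop. 4.16 (p. 101)] -/
instance isClosedImmersion_whiskerLeft_stratumι_left (T : SchemeOver R) [IsAffine T.left] (P : SchemeOver R)
    (𝔭 : PrimeSpectrum Γ(T.left, ⊤)) : IsClosedImmersion (P ◁ Relative.stratumι T 𝔭).left :=
  MorphismProperty.of_isPullback (P := @IsClosedImmersion)
    (isPullback_whiskerLeft_snd_overBase P (Relative.stratumι T 𝔭)).flip inferInstance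

/-- `P ×_R T_𝔭 ↪ P ×_R T` is affine. [folklore] [cite: GortzWedhorn2023, Thm. 23.133, proof, Step (I) (p. 354)] -/
instance isAffineHom_whiskerLeft_stratumι_left (T : SchemeOver R) [IsAffine T.left] (P : SchemeOver R)
    (𝔭 : PrimeSpectrum Γ(T.left, ⊤)) : IsAffineHom (P ◁ Relative.stratumι T 𝔭).left :=
  inferInstance

/-- Preimages of affine opens under `P ×_R T_𝔭 ↪ P ×_R T` are affine. [folklore] [cite: GortzWedhorn2023, Thm. 23.133, proof, Step (I) (p. 354)] -/
theorem isAffineOpen_preimage_whiskerLeft_stratumι (T : SchemeOver R) [IsAffine T.left] (P : SchemeOver R)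
    (𝔭 : PrimeSpectrum Γ(T.left, ⊤)) {U : (P ⊗ T).left.Opens} (hU : IsAffineOpen U) :
    IsAffineOpen ((P ◁ Relative.stratumι T 𝔭).left ⁻¹ᵁ U) :=
  hU.preimage _

end Total

end Relative

end Literature.AlgebraicGeometry.Modules

end
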